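import Literature.Geometry.Lorentzian.TracedGaussEquationGeneral
import Literature.Geometry.Lorentzian.SecondFundamentalFormApply
import Literature.Geometry.Lorentzian.MetricNormSq
import Literature.Geometry.Lorentzian.Hypersurface
import HarnessLib

/-!
# Preliminaries for Hawking's singularity theorem (O'Neill 1983, Ch. 10, Prop. 37)

Pointwise and real-variable ingredients of the Myers–Hawking second-variation computation along a
unit timelike geodesic normal to a spacelike hypersurface (O'Neill 1983, Ch. 10, Prop. 37 and
Thm. 14.55A; Wald 1984, Prop. 9.3.4, Thm. 9.5.1), used by the proof programme of
`Literature.Geometry.Lorentzian.HawkingCrushBound`: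

* `ricci_eq_sum_of_orthonormal_timelike` — `Ric(T, T) = ∑ᵢ g(R(eᵢ, T)T, eᵢ)` for a unit
  timelike `T` and an orthonormal frame `eᵢ` of `T^⊥` (O'Neill 1983, Ch. 3, Lemma 52);
* `meanCurvature_eq_sum_of_isOrthoᵢ` — the mean curvature `H = tr_{f^*g} K_ν` as a frame sum
  (O'Neill 1983, Ch. 3, pp. 60–61; Wald 1984, (10.2.13));
* `covariantDerivAlong_comp_eq_normalDerivAlong` — `D(ν ∘ c)/dt(0) = D_{c'(0)} ν`
  (O'Neill 1983, Ch. 4, Lemma 1): the endmanifold term of the second variation,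
  `⟨σ'(0), II(V(0), V(0))⟩` (O'Neill 1983, Ch. 10, p. 283), is computed through it;
* `one_add_half_sub_sq_le_sqrt`, `integral_nonneg_of_sqrt_integral_le` — the elementary
  expansion `√(1 + z) ≥ 1 + z/2 - z²/2` and the limiting argument turning "every nearby curve
  from the hypersurface is not longer" into `∫₀ᴸ h ≥ 0` for the second-order coefficient `h` of
  `-g(∂_t x, ∂_t x)`.

No definitions and no named facts are introduced (D-0026).

## References

* B. O'Neill, *Semi-Riemannian geometry with applications to relativity*, Academic Press 1983,
  Ch. 3, Lemma 52 and pp. 60–61; Ch. 4, Lemma 1; Ch. 10, Prop. 37, p. 283.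
  [ONeillSemiRiemannian1983]
* R. M. Wald, *General Relativity*, Chicago 1984, Prop. 9.3.4, (10.2.13). [Wald1984GR]
-/

noncomputable section

open Bundle Set Filter Function Manifold
open scoped Manifold ContDiff Topology BigOperators

namespace Literature.Geometry.Lorentzian

namespace PseudoRiemannianMetric

variable {E : Type*} [NormedAddCommGroup E] [NormedSpace ℝ E] {H : Type*} [TopologicalSpace H]
  {I : ModelWithCorners ℝ E H} {M : Type*} [TopologicalSpace M] [ChartedSpace H M]
  [IsManifold I ∞ M] [FiniteDimensional ℝ E] [CompleteSpace E]

/-! ### The timelike Ricci curvature as a trace over an orthonormal complement -/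

omit [CompleteSpace E] in
/-- **`Ric(T, T) = ∑ᵢ g(R(eᵢ, T)T, eᵢ)` for a unit timelike `T` and an orthonormal spacelike
frame `e₁, …, e_m` of `T^⊥`** (`m + 1 = dim M`): the Ricci tensor is the trace of `v ↦ R(v, T)T`
(O'Neill 1983, Ch. 3, Lemma 52: `Ric(X, Y) = ∑ εₘ ⟨R_{XEₘ}Y, Eₘ⟩` in a frame field), computed in
the orthonormal basis `T, e₁, …, e_m` (`ricci_eq_sum_of_isOrthoᵢ`), where the `T`-term
`g(R(T, T)T, T)/g(T, T)` vanishes by antisymmetry. This is the curvature term of the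
Raychaudhuri / Myers–Hawking computation along a unit timelike geodesic (O'Neill 1983, Ch. 10,
proof of Prop. 37; Hawking–Ellis 1973, (4.26)). [cite: ONeillSemiRiemannian1983, Ch. 3, Lemma 52] -/
theorem ricci_eq_sum_of_orthonormal_timelike
    (g : PseudoRiemannianMetric I ∞ E (TangentSpace I : M → Type _)) [g.HasLeviCivita] (x : M)
    {ι : Type*} [Fintype ι] [DecidableEq ι] {T : TangentSpace I x} (hT : g.val x T T = -1)
    {e : ι → TangentSpace I x} (hon : ∀ i j, g.val x (e i) (e j) = if i = j then 1 else 0)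
    (heT : ∀ i, g.val x (e i) T = 0) (hcard : Fintype.card ι + 1 = Module.finrank ℝ E) :
    g.ricci x T T = ∑ i, g.val x (g.riemann x (e i) T T) (e i) := by
  classical
  haveI : FiniteDimensional ℝ (TangentSpace I x) := inferInstanceAs (FiniteDimensional ℝ E)
  set b : Option ι → TangentSpace I x := fun o ↦ o.elim T e with hb
  have hb_none : b none = T := rfl
  have hb_some : ∀ i, b (some i) = e i := fun i ↦ rfl
  have hortho : (g.toBilinForm x).IsOrthoᵢ b := by
    intro o o' hne
    rcases o with _ | i <;> rcases o' with _ | j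
    · exact absurd rfl hne
    · show g.val x T (e j) = 0
      rw [g.symm x]
      exact heT j
    · exact heT i
    · have hij : i ≠ j := fun h ↦ hne (by rw [h])
      show g.val x (e i) (e j) = 0
      rw [hon, if_neg hij]
  have hdiag : ∀ o, g.val x (b o) (b o) ≠ 0 := by
    rintro (_ | i)
    · rw [hb_none, hT]
      norm_num
    · rw [hb_some, hon, if_pos rfl]
      norm_num
  have hli : LinearIndependent ℝ b := LinearMap.linearIndependent_of_isOrthoᵢ hortho hdiag
  have hcard' : Fintype.card (Option ι) = Module.finrank ℝ (TangentSpace I x) := by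
    rw [Fintype.card_option]
    exact hcard
  set β := basisOfLinearIndependentOfCardEqFinrank hli hcard' with hβdef
  have hβ : ⇑β = b := coe_basisOfLinearIndependentOfCardEqFinrank hli hcard'
  have hβo : (g.toBilinForm x).IsOrthoᵢ β := by
    rw [hβ]
    exact hortho
  have hβd : ∀ o, g.val x (β o) (β o) ≠ 0 := by
    rw [hβ]
    exact hdiag
  rw [ricci_eq_sum_of_isOrthoᵢ g x β hβo hβd T T, Fintype.sum_option]
  simp only [hβ, hb_none, hb_some]
  have hRTT : g.riemann x T T T = 0 := by
    have h := g.leviCivita.curvature_antisymm (x := x) T T T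
    have h2 : (2 : ℝ) • g.riemann x T T T = 0 := by
      rw [two_smul]
      show g.leviCivita.curvature x T T T + g.leviCivita.curvature x T T T = 0
      nth_rw 1 [h]
      exact neg_add_cancel _
    exact (smul_eq_zero.1 h2).resolve_left (by norm_num)
  rw [hRTT, map_zero, zero_apply, zero_div, zero_add]
  refine Finset.sum_congr rfl fun i _ ↦ ?_
  rw [hon, if_pos rfl, div_one]

/-! ### The mean curvature as a frame sum -/

variable {E' : Type*} [NormedAddCommGroup E'] [NormedSpace ℝ E'] {H' : Type*} [TopologicalSpace H']
  {I' : ModelWithCorners ℝ E' H'} {N : Type*} [TopologicalSpace N] [ChartedSpace H' N]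
  [IsManifold I' ∞ N] [FiniteDimensional ℝ E'] {n : ℕ∞ω} [Fact (1 ≤ n)]

omit [CompleteSpace E] [Fact (1 ≤ n)] in
/-- **The mean curvature in an orthogonal frame**: for a `(f^* g)`-orthogonal basis `e` of
`T_y N` consisting of non-null vectors, `H(y) = ∑ᵢ K_ν(eᵢ, eᵢ) / (f^* g)(eᵢ, eᵢ)` (the metric
trace `tr_{f^*g} K_ν` of `meanCurvature`, computed with the diagonal Gram matrix,
`repr_eq_div_of_isOrthoᵢ`; O'Neill 1983, Ch. 3, pp. 60–61 and Ch. 4, p. 111; Wald 1984,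
(10.2.13): `K = h^{ab} K_{ab}`). [cite: ONeillSemiRiemannian1983, Ch. 3, pp. 60–61] -/
theorem meanCurvature_eq_sum_of_isOrthoᵢ
    (g : PseudoRiemannianMetric I n E (TangentSpace I : M → Type _)) [g.HasLeviCivita]
    {f : N → M} (hpb : contMDiff_pullbackBilin I M I' N n) (hf : g.IsSpacelikeImmersion I' f)
    (ν : NormalField I f) (y : N)
    (e : Module.Basis (Fin (Module.finrank ℝ (TangentSpace I' y))) ℝ (TangentSpace I' y))
    (he : ((g.inducedMetric f hpb hf).toBilinForm y).IsOrthoᵢ e)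
    (hene : ∀ i, (g.inducedMetric f hpb hf).val y (e i) (e i) ≠ 0) :
    g.meanCurvature f hpb hf ν y =
      ∑ i, g.secondFundamentalForm I' f ν y (e i) (e i) /
        (g.inducedMetric f hpb hf).val y (e i) (e i) := by
  show (g.inducedMetric f hpb hf).trace y (g.secondFundamentalForm I' f ν y) = _
  rw [PseudoRiemannianMetric.trace, LinearMap.trace_eq_matrix_trace ℝ e, Matrix.trace]
  refine Finset.sum_congr rfl fun i _ ↦ ?_
  rw [Matrix.diag_apply, LinearMap.toMatrix_apply,
    repr_eq_div_of_isOrthoᵢ e he (fun i ↦ hene i), LinearMap.comp_apply]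
  simp only [PseudoRiemannianMetric.toBilinForm_apply, LinearEquiv.coe_coe,
    PseudoRiemannianMetric.val_sharp_apply]

/-! ### The covariant derivative of a field along a map, along a curve -/

omit [CompleteSpace E] [FiniteDimensional ℝ E'] [Fact (1 ≤ n)] in
/-- **`D(ν ∘ c)/dt (0) = D_{c'(0)} ν`**: for a field `ν` along `f : N → M`, differentiable at
`c 0` as a map into `TM`, and a curve `c` in `N` differentiable at `0`, the covariant derivative
at `0` of `t ↦ ν(c t)` along `t ↦ f(c t)` is the tree's `normalDerivAlong f ν (c 0) (c' 0)`
(both are given by the same frame formula, `covariantDerivAlong_comp_eq` and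
`normalDerivAlong_eq`: the induced covariant derivative depends on the curve only through its
velocity; O'Neill 1983, Ch. 4, Lemma 1, p. 98). A cross-fibre equation (both sides in `E`).
[cite: ONeillSemiRiemannian1983, Ch. 4, Lemma 1] -/
theorem covariantDerivAlong_comp_eq_normalDerivAlong [I'.Boundaryless]
    (g : PseudoRiemannianMetric I n E (TangentSpace I : M → Type _)) [g.HasLeviCivita]
    {f : N → M} {ν : NormalField I f} {c : ℝ → N}
    (hν : MDifferentiableAt I' I.tangent
      (fun x ↦ (TotalSpace.mk' E (f x) (ν x) : TangentBundle I M)) (c 0))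
    (hc : MDifferentiableAt 𝓘(ℝ, ℝ) I' c 0) :
    covariantDerivAlong g.leviCivita (fun t ↦ f (c t)) (fun t ↦ ν (c t)) 0 =
      g.normalDerivAlong f ν (c 0) (velocity I' c 0) := by
  rw [covariantDerivAlong_comp_eq g.leviCivita f ν hν hc,
    g.normalDerivAlong_eq BoundarylessManifold.isInteriorPoint hν]

end PseudoRiemannianMetric

/-! ### Two real-variable lemmas -/

/-- `√(1 + z) ≥ 1 + z/2 - z²/2` for every real `z` (the right-hand side is positive only
for `-1 < z < 2`, and there its square is `1 + z - z²(3/4 + z/2 - z²/4) ≤ 1 + z`). [folklore] -/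
theorem one_add_half_sub_sq_le_sqrt (z : ℝ) :
    1 + z / 2 - z ^ 2 / 2 ≤ Real.sqrt (1 + z) := by
  by_cases hp : 1 + z / 2 - z ^ 2 / 2 ≤ 0
  · exact hp.trans (Real.sqrt_nonneg _)
  · rw [not_le] at hp
    have hz : -1 < z := by nlinarith [sq_nonneg z]
    have hz' : z < 2 := by nlinarith [sq_nonneg z]
    refine Real.le_sqrt_of_sq_le ?_
    nlinarith [sq_nonneg z, mul_nonneg (sq_nonneg z) (sub_nonneg.2 hz'.le),
      mul_nonneg (sq_nonneg z) (neg_le_iff_add_nonneg.1 hz.le)]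

/-- **The limiting argument of the second variation**: if `h` is continuous on `[0, L]`, `L > 0`,
and for every `ε > 0` there is `δ > 0` such that for all `σ ∈ (0, δ]`
`∫₀ᴸ √(N(t, σ)) dt ≤ L` while `N(t, σ) ≥ 1 - σ²(h(t) + ε)` on `[0, L]` (for a function `N`
continuous on `[0, L] × [0, δ]`... here: each `N(·, σ)` continuous on `[0, L]`), then
`∫₀ᴸ h ≥ 0`. (Expansion `√(1 + z) ≥ 1 + z/2 - z²/2`, `z = -σ²(h + ε)`, division by `σ²` and
`σ → 0`, `ε → 0`; O'Neill 1983, Ch. 10, proof of Thm. 4 / Prop. 37: "`L''(0) ≤ 0` for a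
maximising geodesic".) [folklore] -/
theorem integral_nonneg_of_sqrt_integral_le {L : ℝ} (hL : 0 < L) {h : ℝ → ℝ}
    (hh : ContinuousOn h (Icc 0 L)) {N : ℝ → ℝ → ℝ}
    (hN : ∀ σ, ContinuousOn (fun t ↦ N t σ) (Icc 0 L))
    (hyp : ∀ ε > 0, ∃ δ > 0, ∀ σ ∈ Ioc (0 : ℝ) δ,
      (∫ t in (0 : ℝ)..L, Real.sqrt (N t σ)) ≤ L ∧ ∀ t ∈ Icc 0 L, 1 - σ ^ 2 * (h t + ε) ≤ N t σ) :
    0 ≤ ∫ t in (0 : ℝ)..L, h t := by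
  -- a bound for `|h|` on `[0, L]`
  obtain ⟨K₀, hK₀⟩ := (isCompact_Icc (a := (0 : ℝ)) (b := L)).exists_bound_of_continuousOn hh
  have hhi : IntervalIntegrable h MeasureTheory.volume 0 L := hh.intervalIntegrable_of_Icc hL.le
  -- it suffices to prove `∫ h + ε L ≥ 0` for every `ε ∈ (0, 1]`
  suffices hε : ∀ ε : ℝ, 0 < ε → ε ≤ 1 → -(ε * L) ≤ ∫ t in (0 : ℝ)..L, h t by
    by_contra hneg
    rw [not_le] at hneg
    set ε : ℝ := min 1 ((-∫ t in (0 : ℝ)..L, h t) / (2 * L)) with hεdef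
    have hεpos : 0 < ε := lt_min one_pos (div_pos (by linarith) (by linarith))
    have h1 := hε ε hεpos (min_le_left _ _)
    have h2 : ε * L ≤ (-∫ t in (0 : ℝ)..L, h t) / (2 * L) * L :=
      mul_le_mul_of_nonneg_right (min_le_right _ _) hL.le
    have h3 : (-∫ t in (0 : ℝ)..L, h t) / (2 * L) * L = (-∫ t in (0 : ℝ)..L, h t) / 2 := by
      field_simp
    linarith
  intro ε hε hε1
  set K : ℝ := |K₀| + 1 with hK
  have hKpos : 0 < K := by positivity
  have hhK : ∀ t ∈ Icc 0 L, |h t + ε| ≤ K := fun t ht ↦ by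
    have h1 := hK₀ t ht
    rw [Real.norm_eq_abs] at h1
    calc |h t + ε| ≤ |h t| + |ε| := abs_add_le _ _
      _ ≤ |K₀| + 1 := by
          rw [abs_of_pos hε]
          exact add_le_add (h1.trans (le_abs_self K₀)) hε1
  obtain ⟨δ, hδ, hδp⟩ := hyp ε hε
  set F : ℝ → ℝ := fun t ↦ h t + ε with hF
  have hFi : IntervalIntegrable F MeasureTheory.volume 0 L := hhi.add intervalIntegrable_const
  have hFint : ∫ t in (0 : ℝ)..L, F t = (∫ t in (0 : ℝ)..L, h t) + ε * L := by
    rw [hF, intervalIntegral.integral_add hhi intervalIntegrable_const,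
      intervalIntegral.integral_const, sub_zero, smul_eq_mul, mul_comm]
  -- for every small `σ > 0`: `∫ F ≥ -σ² K² L`
  have hmain : ∀ σ : ℝ, 0 < σ → σ ≤ δ → σ ^ 2 * K ≤ 1 / 2 →
      -(σ ^ 2 * (K ^ 2 * L)) ≤ ∫ t in (0 : ℝ)..L, F t := by
    intro σ hσ hσδ hσK
    obtain ⟨hint, hlow⟩ := hδp σ ⟨hσ, hσδ⟩
    set C : ℝ := σ ^ 4 * K ^ 2 / 2 with hC
    -- pointwise: `√N ≥ (1 - C) - (σ²/2) F`
    have hpt : ∀ t ∈ Icc 0 L, (1 - C) - σ ^ 2 / 2 * F t ≤ Real.sqrt (N t σ) := by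
      intro t ht
      set z : ℝ := -(σ ^ 2 * F t) with hz
      have hFK : |F t| ≤ K := hhK t ht
      have hzabs : |z| ≤ 1 / 2 := by
        rw [hz, abs_neg, abs_mul, abs_of_nonneg (sq_nonneg σ)]
        calc σ ^ 2 * |F t| ≤ σ ^ 2 * K := by gcongr
          _ ≤ 1 / 2 := hσK
      have hz1 : -1 ≤ z := by linarith [(abs_le.1 hzabs).1]
      have h1 : Real.sqrt (1 + z) ≤ Real.sqrt (N t σ) :=
        Real.sqrt_le_sqrt (by rw [hz]; linarith [hlow t ht])
      have h2 := one_add_half_sub_sq_le_sqrt z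
      have h3 : z ^ 2 ≤ σ ^ 4 * K ^ 2 := by
        have h4 : |z| ≤ σ ^ 2 * K := by
          rw [hz, abs_neg, abs_mul, abs_of_nonneg (sq_nonneg σ)]
          gcongr
        have h5 : |z| ^ 2 ≤ (σ ^ 2 * K) ^ 2 := pow_le_pow_left₀ (abs_nonneg _) h4 2
        rw [sq_abs] at h5
        nlinarith
      have hzF : z / 2 = -(σ ^ 2 / 2 * F t) := by
        rw [hz]
        ring
      rw [hC]
      linarith
    -- integrate
    have hcont1 : ContinuousOn (fun t ↦ (1 - C) - σ ^ 2 / 2 * F t) (Icc 0 L) :=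
      continuousOn_const.sub ((hh.add continuousOn_const).const_smul (σ ^ 2 / 2))
    have hcont2 : ContinuousOn (fun t ↦ Real.sqrt (N t σ)) (Icc 0 L) :=
      Real.continuous_sqrt.comp_continuousOn (hN σ)
    have hI := intervalIntegral.integral_mono_on hL.le
      (hcont1.intervalIntegrable_of_Icc (μ := MeasureTheory.volume) hL.le)
      (hcont2.intervalIntegrable_of_Icc (μ := MeasureTheory.volume) hL.le) hpt
    have hsplit : ∫ t in (0 : ℝ)..L, ((1 - C) - σ ^ 2 / 2 * F t) =
        (1 - C) * L - σ ^ 2 / 2 * ∫ t in (0 : ℝ)..L, F t := by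
      rw [intervalIntegral.integral_sub intervalIntegrable_const (hFi.const_mul _),
        intervalIntegral.integral_const, intervalIntegral.integral_const_mul, sub_zero,
        smul_eq_mul, mul_comm]
    rw [hsplit] at hI
    have h6 : (1 - C) * L - σ ^ 2 / 2 * (∫ t in (0 : ℝ)..L, F t) ≤ L := hI.trans hint
    have h7 : σ ^ 2 / 2 * (∫ t in (0 : ℝ)..L, F t) ≥ -(C * L) := by linarith
    have hσ2 : 0 < σ ^ 2 := by positivity
    rw [hC] at h7
    -- divide by `σ² / 2`
    by_contra h8
    rw [not_le] at h8
    have : σ ^ 2 / 2 * (∫ t in (0 : ℝ)..L, F t) < σ ^ 2 / 2 * (-(σ ^ 2 * (K ^ 2 * L))) :=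
      mul_lt_mul_of_pos_left h8 (by positivity)
    nlinarith
  -- let `σ → 0`
  have hFnonneg : 0 ≤ ∫ t in (0 : ℝ)..L, F t := by
    by_contra hneg
    rw [not_le] at hneg
    set A : ℝ := -∫ t in (0 : ℝ)..L, F t with hA
    have hApos : 0 < A := by rw [hA]; linarith
    -- choose `σ` with `σ ≤ δ`, `σ² K ≤ 1/2`, `σ² K² L < A`
    obtain ⟨σ, hσpos, hσ1, hσ2, hσ3⟩ : ∃ σ : ℝ, 0 < σ ∧ σ ≤ δ ∧ σ ^ 2 * K ≤ 1 / 2 ∧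
        σ ^ 2 * (K ^ 2 * L) < A := by
      have hcont : ContinuousAt (fun σ : ℝ ↦ (σ ^ 2 * K, σ ^ 2 * (K ^ 2 * L))) 0 := by
        fun_prop
      have hlim : Tendsto (fun σ : ℝ ↦ (σ ^ 2 * K, σ ^ 2 * (K ^ 2 * L))) (𝓝 0)
          (𝓝 ((0 : ℝ), (0 : ℝ))) := by
        have := hcont.tendsto
        simpa using this
      have hev : ∀ᶠ σ : ℝ in 𝓝 0, σ ^ 2 * K < 1 / 2 ∧ σ ^ 2 * (K ^ 2 * L) < A := by
        have h1 : ∀ᶠ p : ℝ × ℝ in 𝓝 ((0 : ℝ), (0 : ℝ)), p.1 < 1 / 2 ∧ p.2 < A := by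
          have ha : ∀ᶠ p : ℝ × ℝ in 𝓝 ((0 : ℝ), (0 : ℝ)), p.1 < 1 / 2 :=
            (continuous_fst.tendsto _).eventually (Iio_mem_nhds (by norm_num))
          have hb : ∀ᶠ p : ℝ × ℝ in 𝓝 ((0 : ℝ), (0 : ℝ)), p.2 < A :=
            (continuous_snd.tendsto _).eventually (Iio_mem_nhds hApos)
          exact ha.and hb
        exact hlim.eventually h1
      have hev' : ∀ᶠ σ : ℝ in 𝓝[>] 0, σ ^ 2 * K < 1 / 2 ∧ σ ^ 2 * (K ^ 2 * L) < A ∧ σ ≤ δ ∧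
          0 < σ := by
        have h1 : ∀ᶠ σ : ℝ in 𝓝[>] 0, σ ≤ δ := by
          have : Ioc (0 : ℝ) δ ∈ 𝓝[>] (0 : ℝ) := Ioc_mem_nhdsGT hδ
          filter_upwards [this] with σ hσ using hσ.2
        have h2 : ∀ᶠ σ : ℝ in 𝓝[>] 0, (0 : ℝ) < σ := eventually_mem_nhdsWithin
        filter_upwards [nhdsWithin_le_nhds hev, h1, h2] with σ ha hb hc
        exact ⟨ha.1, ha.2, hb, hc⟩
      obtain ⟨σ, hσ⟩ := hev'.exists
      exact ⟨σ, hσ.2.2.2, hσ.2.2.1, hσ.1.le, hσ.2.1⟩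
    have := hmain σ hσpos hσ1 hσ2
    rw [hA] at hσ3
    linarith
  rw [hFint] at hFnonneg
  linarith

end Literature.Geometry.Lorentzian

end
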